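import Summits.Ventures.GridStability.Lyapunov.AdmittanceWeightBounds
import HarnessLib

/-!
# SHARP sparse λ₂-certificates without spectral theory: PSD clique-sum + ONE rank-one negative term (G2-SCALE Q2, wrapper 2)

Venture GRIDFUSION, G2-SCALE cell (lead g19 D25 (i) «one kernel, two wrappers»; §19: T4 = the inertia wrapper,
signature with sos-5), owner gridfusion-sos-5 g9. Wrapper 1 (`GroundedLaplacianSMatCert`) certifies `λ ≤ λ_min(L_g)`,
which loses the interlacing factor (0.25·λ₂ for a path grounded at an end, 0.71 on D1, ≥ 0.92 with the best ground on
feeders). The inertia device certifies the sharp `λ < λ₂` from «`L − λI` has exactly ONE negative pivot». This file makes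
that device ELEMENTARY — no eigenvalues, no Sylvester, no Courant–Fischer: the sparse `LDLᵀ` of `L − λI` with exactly one
negative pivot `p` at elimination step `a` IS the identity `L − λI − p·u uᵀ = Σ_c P_cᵀ S_c P_c` with every `S_c ⪰ 0`
(`u = ℓ_a`, the rational pivot column, support = the clique of `a`), i.e. a PSD clique-sum certificate of the SPARSE matrix
`L − λI − p·u uᵀ` (the rank-one patch lives on one clique) — exactly the tree lane's object (`cliqueSweepS` + `ldlAll`). And
«`L − λI − p·u uᵀ ⪰ 0`, `Σᵢ uᵢ ≠ 0`, `λ ≥ 0`» (the sign of `p` is never used) imply the chains' `hlam(λ)` by a two-line argument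
(`connectivity_certificate_of_rankOne_quadForm`): shift `z` to mean zero, then add the constant `t·𝟙` that kills `u·x`;
the energy is shift-invariant, `pairNormSq z = N Σ z'ᵢ²`, and `λN t² ≥ 0` is the only slack. For `λ < λ₂(L)` such a
decomposition always exists (one negative pivot; `Σ uᵢ = 1 + Σ_j b_j/p > 0` on a Laplacian clique), so the device is
SHARP up to the back-off; size = wrapper 1's + `(w+1)²` patch entries.

KERNEL FORMAT (`sharpSMat n W λ p us`): row `i` = `[(i, Σ_u w_{iu} − λ)] ++ (−1)·W[i] ++ (−p·uᵢ)·us` with `us : SRow ℚ`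
the sparse `u`; obligations `colsBelow`, `eqCheck/transpose` (symmetry), `us` columns in range, `srowTotal us ≠ 0` (`p` free),
`cliqueSweepS n 0 n (sharpSMat …) bs`, `ldlAll bs` — all `decide`, linear cost. THREE COLUMNS. CERTIFIED (kernel): everything
here. VALIDATED / MODELLED: nothing. [cite: DorflerBullo2012, arXiv:0910.5673 §5.1 proof of Thm 5.1 (‖Hδ‖² = n‖δ_⊥‖²); ZhengFantuzziPapachristodoulou2018, §3.2 Theorem 2 («if» direction); BarrettEtAl1994, §4.3.1 «Compressed Row Storage (CRS)», p. 57]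
-/

namespace Summit.Ventures.GridStability.Lyapunov

open Finset Matrix
open Literature.MathematicalPhysics.PowerSystems
open Literature.Computation.Certificates Literature.Computation.Certificates.PSD

variable {m : ℕ}

/-! ## The elementary sharp lemma (quadratic forms only) -/

/-- **Sharp certificate, quadratic-form version.** If `λ ≥ 0`, `Σᵢ uᵢ ≠ 0` and (for ANY real `p` — its sign is never used)
`½ΣΣ aᵢⱼ(xᵢ − xⱼ)² − λΣxᵢ² − p(Σuᵢxᵢ)² ≥ 0` for every `x`, then `∀ z, λ·pairNormSq z ≤ (m+1)·½ΣΣ aᵢⱼ(zᵢ − zⱼ)²`.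
Proof: replace `z` by `x = z − mean(z)·𝟙 + t·𝟙` with `t` chosen so that `Σ uᵢxᵢ = 0`; the energy is shift-invariant,
`pairNormSq z = (m+1)·Σ(zᵢ − mean)²`, and `Σ xᵢ² = Σ(zᵢ − mean)² + (m+1)t²`. [cite: DorflerBullo2012, arXiv:0910.5673 §5.1 proof of Thm 5.1] -/
theorem connectivity_certificate_of_rankOne_quadForm (a : Fin (m + 1) → Fin (m + 1) → ℝ) (lam : ℝ)
    (hlam : 0 ≤ lam) (p : ℝ) (u : Fin (m + 1) → ℝ) (hu : ∑ i, u i ≠ 0)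
    (h : ∀ x : Fin (m + 1) → ℝ,
      0 ≤ 1 / 2 * ∑ i, ∑ j, a i j * (x i - x j) ^ 2 - lam * ∑ i, x i ^ 2 - p * (∑ i, u i * x i) ^ 2) :
    ∀ z : Fin (m + 1) → ℝ,
      lam * pairNormSq z ≤ ((m + 1 : ℕ) : ℝ) * (1 / 2 * ∑ i, ∑ j, a i j * (z i - z j) ^ 2) := by
  intro z
  have hN : (0 : ℝ) < ((m + 1 : ℕ) : ℝ) := by positivity
  set c : ℝ := (∑ i, z i) / ((m + 1 : ℕ) : ℝ) with hc
  set t : ℝ := -(∑ i, u i * (z i - c)) / ∑ i, u i with ht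
  -- the shifted vectors
  have hz' : ∑ i, (z i - c) = 0 := by
    rw [Finset.sum_sub_distrib, Finset.sum_const, Finset.card_univ, Fintype.card_fin, nsmul_eq_mul, hc]
    field_simp
    ring
  have hux : ∑ i, u i * (z i - c + t) = 0 := by
    have : ∑ i, u i * (z i - c + t) = ∑ i, u i * (z i - c) + t * ∑ i, u i := by
      rw [Finset.mul_sum, ← Finset.sum_add_distrib]
      exact Finset.sum_congr rfl fun i _ => by ring
    rw [this, ht, div_mul_cancel₀ _ hu]
    ring
  have hx := h fun i => z i - c + t
  have hE : (1 / 2 : ℝ) * ∑ i, ∑ j, a i j * ((z i - c + t) - (z j - c + t)) ^ 2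
      = 1 / 2 * ∑ i, ∑ j, a i j * (z i - z j) ^ 2 := by
    congr 1
    exact Finset.sum_congr rfl fun i _ => Finset.sum_congr rfl fun j _ => by ring
  have hxx : ∑ i, (z i - c + t) ^ 2 = ∑ i, (z i - c) ^ 2 + ((m + 1 : ℕ) : ℝ) * t ^ 2 := by
    have : ∀ i, (z i - c + t) ^ 2 = (z i - c) ^ 2 + 2 * t * (z i - c) + t ^ 2 := fun i => by ring
    simp_rw [this]
    rw [Finset.sum_add_distrib, Finset.sum_add_distrib, ← Finset.mul_sum, hz', Finset.sum_const,
      Finset.card_univ, Fintype.card_fin, nsmul_eq_mul]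
    ring
  have hP : pairNormSq z = ((m + 1 : ℕ) : ℝ) * ∑ i, (z i - c) ^ 2 := by
    rw [← pairNormSq_shift z c, pairNormSq_eq, hz']
    ring
  rw [hE, hxx, hux] at hx
  rw [hP]
  have h0 : 0 ≤ lam * (((m + 1 : ℕ) : ℝ) * t ^ 2) := mul_nonneg hlam (mul_nonneg hN.le (sq_nonneg t))
  have h1 : lam * ∑ i, (z i - c) ^ 2 ≤ 1 / 2 * ∑ i, ∑ j, a i j * (z i - z j) ^ 2 := by nlinarith
  nlinarith [mul_le_mul_of_nonneg_left h1 hN.le]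

/-! ## The patched matrix and its quadratic form -/

/-- The real patched shifted Laplacian `L(a) − λI − p·u uᵀ`. [cite: DorflerBullo2013, arXiv:1102.2950 §2.6] -/
def sharpMatrix (a : Fin (m + 1) → Fin (m + 1) → ℝ) (lam p : ℝ) (u : Fin (m + 1) → ℝ) :
    Matrix (Fin (m + 1)) (Fin (m + 1)) ℝ :=
  Matrix.of fun i j => (if i = j then (∑ k, a i k) - lam else 0) - a i j - p * u i * u j

/-- Its rational twin. [cite: DorflerBullo2013, arXiv:1102.2950 §2.6] -/
def sharpMatrixQ (aQ : Fin (m + 1) → Fin (m + 1) → ℚ) (lam p : ℚ) (u : Fin (m + 1) → ℚ) :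
    Matrix (Fin (m + 1)) (Fin (m + 1)) ℚ :=
  Matrix.of fun i j => (if i = j then (∑ k, aQ i k) - lam else 0) - aQ i j - p * u i * u j

/-- Casting commutes with the patched formula. [folklore] -/
theorem sharpMatrix_ratCast (aQ : Fin (m + 1) → Fin (m + 1) → ℚ) (lam p : ℚ) (u : Fin (m + 1) → ℚ) :
    sharpMatrix (fun i j => (aQ i j : ℝ)) (lam : ℝ) (p : ℝ) (fun i => (u i : ℝ))
      = (sharpMatrixQ aQ lam p u).map (Rat.cast : ℚ → ℝ) := by
  ext i j
  simp only [sharpMatrix, sharpMatrixQ, Matrix.map_apply, Matrix.of_apply]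
  split_ifs <;> push_cast <;> ring

/-- **Quadratic form of the patched matrix** (symmetric `a`):
`xᵀ(L − λI − p·uuᵀ)x = ½ΣΣ aᵢⱼ(xᵢ − xⱼ)² − λΣxᵢ² − p(Σuᵢxᵢ)²`. [folklore] -/
theorem sharpMatrix_quadForm (a : Fin (m + 1) → Fin (m + 1) → ℝ) (ha : ∀ i j, a i j = a j i)
    (lam p : ℝ) (u x : Fin (m + 1) → ℝ) :
    dotProduct x ((sharpMatrix a lam p u).mulVec x)
      = 1 / 2 * ∑ i, ∑ j, a i j * (x i - x j) ^ 2 - lam * ∑ i, x i ^ 2 - p * (∑ i, u i * x i) ^ 2 := by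
  have hE : (1 / 2 : ℝ) * ∑ i, ∑ j, a i j * (x i - x j) ^ 2 = ∑ i, x i * ∑ j, a i j * (x i - x j) := by
    rw [sum_sum_mul_sub_sq a ha x]; ring
  rw [hE]
  simp only [dotProduct, Matrix.mulVec, sharpMatrix, Matrix.of_apply]
  -- row i: Σ_j [(δᵢⱼ(degᵢ − λ)) − aᵢⱼ − p uᵢ uⱼ] xⱼ = (degᵢ − λ) xᵢ − Σ_j aᵢⱼ xⱼ − p uᵢ Σ_j uⱼ xⱼ
  have hrow : ∀ i, ∑ j, ((if i = j then (∑ k, a i k) - lam else 0) - a i j - p * u i * u j) * x j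
      = ((∑ k, a i k) - lam) * x i - ∑ j, a i j * x j - p * u i * ∑ j, u j * x j := by
    intro i
    have h1 : ∀ j, ((if i = j then (∑ k, a i k) - lam else 0) - a i j - p * u i * u j) * x j
        = (if i = j then ((∑ k, a i k) - lam) * x j else 0) - a i j * x j - p * u i * (u j * x j) :=
      fun j => by split_ifs <;> ring
    simp_rw [h1]
    rw [Finset.sum_sub_distrib, Finset.sum_sub_distrib, Finset.sum_ite_eq Finset.univ i,
      if_pos (Finset.mem_univ i), ← Finset.mul_sum]
  simp_rw [hrow]
  have h2 : ∀ i, x i * (((∑ k, a i k) - lam) * x i - ∑ j, a i j * x j - p * u i * ∑ j, u j * x j)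
      = x i * ∑ j, a i j * (x i - x j) - lam * x i ^ 2 - p * ((u i * x i) * ∑ j, u j * x j) := by
    intro i
    have key : (∑ k, a i k) * x i - ∑ j, a i j * x j = ∑ j, a i j * (x i - x j) := by
      rw [Finset.sum_mul, ← Finset.sum_sub_distrib]
      exact Finset.sum_congr rfl fun j _ => by ring
    rw [← key]; ring
  simp_rw [h2]
  rw [Finset.sum_sub_distrib, Finset.sum_sub_distrib, ← Finset.mul_sum, ← Finset.mul_sum, ← Finset.sum_mul, sq]

/-- **Sharp certificate, matrix version**: `L(a) − λI − p·uuᵀ ⪰ 0`, `λ ≥ 0`, `Σuᵢ ≠ 0` ⇒ `hlam(λ)` (any real `p`).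
[cite: DorflerBullo2012, arXiv:0910.5673 §5.1 proof of Thm 5.1] -/
theorem connectivity_certificate_of_sharp_posSemidef (a : Fin (m + 1) → Fin (m + 1) → ℝ)
    (ha : ∀ i j, a i j = a j i) (lam : ℝ) (hlam : 0 ≤ lam) (p : ℝ)
    (u : Fin (m + 1) → ℝ) (hu : ∑ i, u i ≠ 0) (hQ : Matrix.PosSemidef (sharpMatrix a lam p u)) :
    ∀ z : Fin (m + 1) → ℝ,
      lam * pairNormSq z ≤ ((m + 1 : ℕ) : ℝ) * (1 / 2 * ∑ i, ∑ j, a i j * (z i - z j) ^ 2) := by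
  refine connectivity_certificate_of_rankOne_quadForm a lam hlam p u hu fun x => ?_
  have h := hQ.dotProduct_mulVec_nonneg x
  have h' : 0 ≤ dotProduct x ((sharpMatrix a lam p u).mulVec x) := by simpa using h
  rwa [sharpMatrix_quadForm a ha lam p u x] at h'

/-! ## The patched rows, computed in the kernel -/

/-- Row `i` of `L − λI − p·uuᵀ` as a sparse row: the diagonal `Σ_u w_{iu} − λ`, the negated neighbours, and the
patch `(−p·uᵢ)·us`. [cite: BarrettEtAl1994, §4.3.1, p. 57] -/
def sharpRow (W : SMat ℚ) (lam p : ℚ) (us : SRow ℚ) (i : ℕ) : SRow ℚ :=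
  [(i, srowTotal (W.getD i []) - lam)] ++ SRow.scale (-1) (W.getD i [])
    ++ SRow.scale (-(p * SRow.fn us i)) us

/-- All `n` patched rows. [cite: BarrettEtAl1994, §4.3.1, p. 57] -/
def sharpSMat (n : ℕ) (W : SMat ℚ) (lam p : ℚ) (us : SRow ℚ) : SMat ℚ :=
  (List.range n).map (sharpRow W lam p us)

/-- **The computed rows ARE the patched matrix** of the kernel weights and the sparse `u`.
[cite: BarrettEtAl1994, §4.3.1, p. 57] -/
theorem matrixOfSparseRows_sharpSMat (W : SMat ℚ) (hW : colsBelow (m + 1) W = true) (lam p : ℚ)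
    (us : SRow ℚ) :
    matrixOfSparseRows (m + 1) (m + 1) (sharpSMat (m + 1) W lam p us)
      = sharpMatrixQ (matrixOfSparseRows (m + 1) (m + 1) W) lam p (fun i => SRow.fn us i.val) := by
  ext i j
  have hrow : (sharpSMat (m + 1) W lam p us).getD i.val [] = sharpRow W lam p us i.val := by
    rw [sharpSMat, List.getD_eq_getElem?_getD, List.getElem?_map, List.getElem?_range i.isLt]
    rfl
  rw [matrixOfSparseRows_apply, hrow, sharpRow, SRow.fn_append, SRow.fn_append, SRow.fn_scale, SRow.fn_scale,
    SRow.fn_cons, SRow.fn_nil, sharpMatrixQ, Matrix.of_apply]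
  simp only [matrixOfSparseRows_apply]
  rw [sum_fn_eq_srowTotal _ (all_lt_of_colsBelow hW i.val)]
  by_cases hij : i = j
  · subst hij
    rw [if_pos rfl, if_pos rfl]
    ring
  · rw [if_neg (fun h => hij (Fin.ext h)), if_neg hij]
    ring

/-- **SHARP sparse connectivity certificate (wrapper 2), rational weights.** Data: `W` (weights), `λ ≥ 0`, any `p`, the
sparse rank-one column `us` (`Σ uᵢ ≠ 0`, columns in range) and PSD clique blocks `bs` of `L − λI − p·uuᵀ`; all
obligations are `decide`s of linear cost. Conclusion = the chains' `hlam(λ)` for the weights `matrixOfSparseRows N N W`,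
with `λ` up to `λ₂` (no interlacing loss). [cite: ZhengFantuzziPapachristodoulou2018, §3.2 Theorem 2 («if» direction); DorflerBullo2012, arXiv:0910.5673 §5.1] -/
theorem sharp_connectivity_certificate_of_smat {d : ℕ} (W : SMat ℚ) (hd : m + 1 ≤ 2 ^ d)
    (hW : colsBelow (m + 1) W = true)
    (hsym : SMat.eqCheck (m + 1) W (SMat.transpose d (m + 1) W) = true)
    (lam : ℚ) (hlam : 0 ≤ lam) (p : ℚ) (us : SRow ℚ)
    (hus : (us.all fun q => decide (q.1 < m + 1)) = true) (hu : srowTotal us ≠ 0)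
    (bs : List (Block (m + 1) ℚ))
    (hsweep : cliqueSweepS (m + 1) 0 (m + 1) (sharpSMat (m + 1) W lam p us) bs = true)
    (hldl : ldlAll bs = true) :
    ∀ z : Fin (m + 1) → ℝ,
      (lam : ℝ) * pairNormSq z
        ≤ ((m + 1 : ℕ) : ℝ) *
          (1 / 2 * ∑ i, ∑ j, ((matrixOfSparseRows (m + 1) (m + 1) W i j : ℚ) : ℝ) * (z i - z j) ^ 2) := by
  have hpsd : ((matrixOfSparseRows (m + 1) (m + 1) (sharpSMat (m + 1) W lam p us)).map
      (Rat.cast : ℚ → ℝ)).PosSemidef :=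
    posSemidef_map_of_cliqueSweepS_ldl hsweep hldl
  rw [matrixOfSparseRows_sharpSMat W hW, ← sharpMatrix_ratCast] at hpsd
  have hu' : ∑ i : Fin (m + 1), ((SRow.fn us i.val : ℚ) : ℝ) ≠ 0 := by
    have h1 : ∑ i : Fin (m + 1), SRow.fn us i.val = srowTotal us := sum_fn_eq_srowTotal us hus
    have h2 : ((∑ i : Fin (m + 1), SRow.fn us i.val : ℚ) : ℝ) ≠ 0 := by
      rw [h1]; exact_mod_cast hu
    push_cast at h2
    exact h2
  exact connectivity_certificate_of_sharp_posSemidef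
    (fun i j => ((matrixOfSparseRows (m + 1) (m + 1) W i j : ℚ) : ℝ))
    (fun i j => by exact_mod_cast symm_of_eqCheck_transpose hd W hsym i j) (lam : ℝ) (by exact_mod_cast hlam)
    (p : ℝ) _ hu' hpsd

/-- **SHARP certificate for the REAL admittance weights** `‖Yᵢⱼ‖ = (rᵢⱼ² + xᵢⱼ²)^{-1/2}` (lower brackets + monotone
transfer). [cite: GrossEtAl2019, eq. (1); ZhengFantuzziPapachristodoulou2018, §3.2 Theorem 2 («if» direction)] -/
theorem sharp_connectivity_certificate_admittance {d : ℕ} (ZW : ZWRows) (hlo : lowerCheck ZW = true)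
    (hd : m + 1 ≤ 2 ^ d) (hW : colsBelow (m + 1) (bracketSMat ZW) = true)
    (hsym : SMat.eqCheck (m + 1) (bracketSMat ZW) (SMat.transpose d (m + 1) (bracketSMat ZW)) = true)
    (lam : ℚ) (hlam : 0 ≤ lam) (p : ℚ) (us : SRow ℚ)
    (hus : (us.all fun q => decide (q.1 < m + 1)) = true) (hu : srowTotal us ≠ 0)
    (bs : List (Block (m + 1) ℚ))
    (hsweep : cliqueSweepS (m + 1) 0 (m + 1) (sharpSMat (m + 1) (bracketSMat ZW) lam p us) bs = true)
    (hldl : ldlAll bs = true) :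
    ∀ z : Fin (m + 1) → ℝ, (lam : ℝ) * pairNormSq z
      ≤ ((m + 1 : ℕ) : ℝ) * (1 / 2 * ∑ i, ∑ j, admittanceKernel (m + 1) ZW i j * (z i - z j) ^ 2) :=
  connectivity_certificate_of_le_weights _ _ (le_admittanceKernel_of_lowerCheck (m + 1) ZW hlo) _
    (sharp_connectivity_certificate_of_smat (bracketSMat ZW) hd hW hsym lam hlam p us hus hu bs hsweep hldl)

end Summit.Ventures.GridStability.Lyapunov
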